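import Literature.AlgebraicGeometry.Resolution.AdicCompletionRegular
import Mathlib.FieldTheory.Separable
import HarnessLib

/-!
# Crux `Steer` (stmt-ResolutionOfSingularities-16345), chain W4.1, K3ᴳ / ℓ-COMPARISON last mile, piece (c): residual SEPARABILITY and a residue BASIS
# pass from `S → S′` to the completed map `Ŝ → Ŝ′`

OURS (campaign `res-hironaka`, rung L ★L-G4, slot W4.1; seat res-L0-w41-stub-2 g6; `K3G/JacobianLengthEtale-PLAN.md` §v1.3 (c)). Theses-free, definition-free.
Along the residue isomorphisms `κ(S) ≅ κ(Ŝ)`, `κ(S′) ≅ κ(Ŝ′)` (`AdicCompletion.residueField_map_bijective`) the square with `κ(φ)` and `κ(ψ)` commutes (`ψ`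
over `φ`), so separability (`Algebra.IsSeparable.of_equiv_equiv`) and a finite residue basis in SUM FORM transport — the two residue hypotheses of
`JacobianLength.length_quotient_span_derivation_le_of_completed` (p569745). [folklore]

* `ResidueTransport.map_residue_equiv_comm` — the residue square of `ψ` over `φ`;
* `ResidueTransport.isSeparable_completed`, `ResidueTransport.exists_basis_completed`.
-/

noncomputable section

set_option linter.dupNamespace false

open IsLocalRing

namespace Summit.ResolutionOfSingularities.ResolutionOfSingularities.Theorems.SwitchingDichotomy.ResidueTransport

variable {S S' : Type} [CommRing S] [CommRing S'] [IsLocalRing S] [IsNoetherianRing S] [IsLocalRing S'] [IsNoetherianRing S']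

/-- The residue square: `κ(ψ) ∘ (κ(S) ≅ κ(Ŝ)) = (κ(S′) ≅ κ(Ŝ′)) ∘ κ(φ)` for a completed map `ψ` over `φ`. -/
theorem map_residue_equiv_comm (φ : S →+* S') [IsLocalHom φ]
    (ψ : AdicCompletion (maximalIdeal S) S →+* AdicCompletion (maximalIdeal S') S') [IsLocalHom ψ]
    (hψ : ∀ s, ψ (algebraMap S _ s) = algebraMap S' _ (φ s)) (c : ResidueField S) :
    ResidueField.map ψ (RingEquiv.ofBijective _ (AdicCompletion.residueField_map_bijective S) c) =
      RingEquiv.ofBijective _ (AdicCompletion.residueField_map_bijective S') (ResidueField.map φ c) := by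
  obtain ⟨s, rfl⟩ := residue_surjective c
  rw [RingEquiv.ofBijective_apply, RingEquiv.ofBijective_apply, ResidueField.map_residue, ResidueField.map_residue, ResidueField.map_residue,
    ResidueField.map_residue, hψ]

/-- **Residual separability passes to the completed map.** -/
theorem isSeparable_completed (φ : S →+* S') [IsLocalHom φ]
    (ψ : AdicCompletion (maximalIdeal S) S →+* AdicCompletion (maximalIdeal S') S') [IsLocalHom ψ]
    (hψ : ∀ s, ψ (algebraMap S _ s) = algebraMap S' _ (φ s))
    (hsep : @Algebra.IsSeparable (ResidueField S) (ResidueField S') _ _ (ResidueField.map φ).toAlgebra) :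
    @Algebra.IsSeparable (ResidueField (AdicCompletion (maximalIdeal S) S)) (ResidueField (AdicCompletion (maximalIdeal S') S')) _ _
      (ResidueField.map ψ).toAlgebra := by
  letI : Algebra (ResidueField S) (ResidueField S') := (ResidueField.map φ).toAlgebra
  letI : Algebra (ResidueField (AdicCompletion (maximalIdeal S) S)) (ResidueField (AdicCompletion (maximalIdeal S') S')) :=
    (ResidueField.map ψ).toAlgebra
  haveI := hsep
  refine Algebra.IsSeparable.of_equiv_equiv (RingEquiv.ofBijective _ (AdicCompletion.residueField_map_bijective S))
    (RingEquiv.ofBijective _ (AdicCompletion.residueField_map_bijective S')) (RingHom.ext fun c => ?_)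
  exact map_residue_equiv_comm φ ψ hψ c

/-- **A finite residue basis in sum form passes to the completed map.** -/
theorem exists_basis_completed (φ : S →+* S') [IsLocalHom φ]
    (ψ : AdicCompletion (maximalIdeal S) S →+* AdicCompletion (maximalIdeal S') S') [IsLocalHom ψ]
    (hψ : ∀ s, ψ (algebraMap S _ s) = algebraMap S' _ (φ s))
    {ι : Type} [Fintype ι] (b₀ : ι → ResidueField S')
    (hb₀ : ∀ c, ∃! g : ι → ResidueField S, c = ∑ j, ResidueField.map φ (g j) * b₀ j) :
    ∃ b : ι → ResidueField (AdicCompletion (maximalIdeal S') S'),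
      ∀ c, ∃! g : ι → ResidueField (AdicCompletion (maximalIdeal S) S), c = ∑ j, ResidueField.map ψ (g j) * b j := by
  classical
  set e := RingEquiv.ofBijective _ (AdicCompletion.residueField_map_bijective S) with he
  set e' := RingEquiv.ofBijective _ (AdicCompletion.residueField_map_bijective S') with he'
  have hcomm : ∀ c, ResidueField.map ψ (e c) = e' (ResidueField.map φ c) := map_residue_equiv_comm φ ψ hψ
  refine ⟨fun j => e' (b₀ j), fun c => ?_⟩
  obtain ⟨g, hg, huniq⟩ := hb₀ (e'.symm c)
  refine ⟨fun j => e (g j), ?_, fun g' hg' => ?_⟩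
  · change c = ∑ j, ResidueField.map ψ (e (g j)) * e' (b₀ j)
    simp_rw [hcomm, ← map_mul, ← map_sum, ← hg, RingEquiv.apply_symm_apply]
  · have h := huniq (fun j => e.symm (g' j)) (by
      apply e'.injective
      rw [RingEquiv.apply_symm_apply, map_sum]
      simp_rw [map_mul, ← hcomm, RingEquiv.apply_symm_apply]
      exact hg')
    funext j
    rw [← h, RingEquiv.apply_symm_apply]

end Summit.ResolutionOfSingularities.ResolutionOfSingularities.Theorems.SwitchingDichotomy.ResidueTransport

end
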